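import Mathlib
import Summits.MatrixMultiplication.MatrixMultiplication.Theorems.SnSubsetDichotomyThresholdSubsetTriplesChainDefs

/-!
# `SnSubsetDichotomy.ThresholdSubsetTriples`, line `interleaved-subsignature-ascent` — stub `subsig_succ`
# (explicit / elementary route)

Registered stub `subsig_succ` of crux `stmt-MatrixMultiplication-10882`
(`Summit.MatrixMultiplication.MatrixMultiplication.Theses.SnSubsetDichotomy.ThresholdSubsetTriples`,
line `interleaved-subsignature-ascent`, skeleton
`Cruxes/ThresholdSubsetTriples/Lines/interleaved_subsignature_ascent.lean`): the TOP-LEVEL PEELING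
of a sub-signature (chain) class on `n + 1` points,

  `subsig D = starPiece (D (Fin.last n)) (Fin.last n) * subsigBelow D n`,

i.e. `S_D = P_n · S_{D,<n}` where `P_n = {swap d n : d ∈ D n}` is the star piece of the top level and
`S_{D,<n}` is the pointwise product of the star pieces of the levels `< n` (top level leftmost).
This is the identity through which the skeleton's glue `ThresholdSubsetTriples_of` feeds the
one-level token elimination `stub_push` (TPP of the three chain classes ⇔ `LevelCondition` at the
top token over the three lower classes).

The proof is EXPLICIT and ELEMENTARY — no induction, no cardinality, no group theory: the chain
class is by definition the `(n+1)`-st iterate `subsigBelow D (n + 1)` (`subsig_eq`), one unfolding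
of the iterate at a level inside the range multiplies by that level's star piece
(`subsigBelow_succ_of_lt` at `n < n + 1`), and the level-`n` point `⟨n, _⟩ : Fin (n + 1)` IS
`Fin.last n` (`Fin.last n = ⟨n, n.lt_succ_self⟩` by definition).  We spell the three steps out as
separate lemmas (`subsig_eq_subsigBelow_succ`, `subsigBelow_succ_last`, and the assembled
`subsig_succ`) and also record the pointwise/membership form (`mem_subsig_succ_iff`): a permutation
lies in the chain class iff it is a top star letter `swap d (last)`, `d ∈ D (last)`, times a word of
the lower class.

The vocabulary (`starPiece`, `subsigBelow`, `subsig`, `subsig_eq`, `subsigBelow_succ_of_lt`,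
`mem_starPiece`) is the landed file `Theorems/SnSubsetDichotomyThresholdSubsetTriplesChainDefs.lean`;
nothing is redefined here and no statement of the route is touched.  The declarations live in the
sub-namespace `…Theorems.ThresholdSubsetTriples.SubsigSuccExplicit` so that the stub keeps its
registered short name `subsig_succ`.
Sources: Fisher–Yates / Sims stabiliser-chain normal form (folklore).
-/

-- `Summit.<Summit>.<Problem>` is the tree's mandated summit-side namespace; for this
-- single-conjunct summit the two coincide, so the file silences `dupNamespace`.
set_option linter.dupNamespace false
set_option autoImplicit false

namespace Summit.MatrixMultiplication.MatrixMultiplication.Theorems.ThresholdSubsetTriples.SubsigSuccExplicit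

open scoped Pointwise

variable {n : ℕ}

/-- Step 1 (definitional): the chain class of a system on `n + 1` points is the `(n+1)`-st iterate of
the level products, `S_D = subsigBelow D (n + 1)`. [folklore] -/
theorem subsig_eq_subsigBelow_succ (D : Fin (n + 1) → Finset (Fin (n + 1))) :
    subsig D = subsigBelow D (n + 1) :=
  subsig_eq D

/-- Step 2 (one unfolding inside the range): the `(n+1)`-st iterate is the star piece of the top level
`Fin.last n = ⟨n, n.lt_succ_self⟩` times the `n`-th iterate,
`subsigBelow D (n + 1) = P_{last} * subsigBelow D n`. [folklore] -/
theorem subsigBelow_succ_last (D : Fin (n + 1) → Finset (Fin (n + 1))) :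
    subsigBelow D (n + 1) = starPiece (D (Fin.last n)) (Fin.last n) * subsigBelow D n :=
  subsigBelow_succ_of_lt D n.lt_succ_self

/-- **Stub `subsig_succ` (top-level peeling of a chain class).**  On `n + 1` points,
`subsig D = starPiece (D (Fin.last n)) (Fin.last n) * subsigBelow D n`: the sub-signature class is
the top star piece `{swap d (last) : d ∈ D (last)}` times the class of the lower levels — steps 1 and
2 chained. [folklore: Fisher–Yates / Sims stabiliser-chain factorisation] -/
theorem subsig_succ (D : Fin (n + 1) → Finset (Fin (n + 1))) :
    subsig D = starPiece (D (Fin.last n)) (Fin.last n) * subsigBelow D n :=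
  (subsig_eq_subsigBelow_succ D).trans (subsigBelow_succ_last D)

/-- Membership form of the peeling (explicit): `σ ∈ S_D` iff `σ = swap d (last) * τ` for some top
direction `d ∈ D (last)` and some word `τ` of the lower class `subsigBelow D n`. [folklore] -/
theorem mem_subsig_succ_iff (D : Fin (n + 1) → Finset (Fin (n + 1))) (σ : Equiv.Perm (Fin (n + 1))) :
    σ ∈ subsig D ↔
      ∃ d ∈ D (Fin.last n), ∃ τ ∈ subsigBelow D n, Equiv.swap d (Fin.last n) * τ = σ := by
  rw [subsig_succ D, Finset.mem_mul]
  constructor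
  · rintro ⟨x, hx, τ, hτ, rfl⟩
    obtain ⟨d, hd, rfl⟩ := mem_starPiece.1 hx
    exact ⟨d, hd, τ, hτ, rfl⟩
  · rintro ⟨d, hd, τ, hτ, rfl⟩
    exact ⟨Equiv.swap d (Fin.last n), mem_starPiece.2 ⟨d, hd, rfl⟩, τ, hτ, rfl⟩

end Summit.MatrixMultiplication.MatrixMultiplication.Theorems.ThresholdSubsetTriples.SubsigSuccExplicit
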